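import Mathlib
import Summits.NavierStokesRegularity.NavierStokesRegularity.Theorems.HeteroclinicTriggerChainTriggerChainFrontStepLatticeSeed
import HarnessLib

/-!
# `HeteroclinicTriggerChain` — crux `TriggerChainFrontStep` (item stmt-NavierStokesRegularity-22785):
  the SEED ROW AT AN ARBITRARY SHELL of an exact flow of the pinned table (gains `2^{5k/2}`)

`…LatticeSeed` identifies the upper-trigger row at shell `1`. The same structure holds at every shell
`k` — needed for the TAIL (the triggers two and more shells ahead of the front are seeded by the shell
below them and must stay within the Gaussian tolerances) and for hops before rescaling. For an exact flow
`S` of `α₀ + βσ` (normal form at `i₀`, parity at `i₁` for both tables, `σ` symmetric, `|α₀| ≤ 1`,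
`|σ| ≤ σ̄`), with `v = S_{i₁,k}`, `y = S_{i₀,k}`, `x = S_{i₀,k−1}`, `u = S_{i₁,k−1}`,
`γ₀ = 2^{5k/2}`, `γ₁ = 2^{5(k−1)/2}`:

  `v′ = γ₀·e·y·v + γ₁·β·s·x·u + f_v`,  `s = 2σ i₁ i₀ i₁ (0,0,1)`,
  `|f_v| ≤ γ₀·( 2V(2ι + 4Z + 4βσ̄(A + Z)) + 2Z(2ι + 4βσ̄A) ) + γ₁·4Mι(1 + βσ̄)`

(`htcLT_seed_row_shell`), from envelopes `V ≥ |v|`, `Z ≥ |S_{b,k+1}|`, `A ≥ |S_{b,k}|`, `ι ≥` junk at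
shells `k−1, k`, `M ≥ |u|`. At `k = 1` this is `htcLS_upper_trigger_forced` (with `2^{5/2} ≤ 6`).

HONEST FRAMING: a statement about exact flows of Tao-type MODEL lattices (Tao 2016 §4) under envelope
hypotheses supplied elsewhere; helper for the crux (no stub credit); nothing here is a statement about
the Navier–Stokes equations; no summit, rung or crux is proved.
-/

noncomputable section

set_option linter.dupNamespace false

open Real Set

namespace Summit.NavierStokesRegularity.NavierStokesRegularity.Theorems

open Literature.Analysis.FluidPDE Literature.Analysis.FluidPDE.TaoCascade

/-- **SEED ROW AT SHELL `k`.** See the module docstring (gains written `(1+1)^{5k/2}`,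
`(1+1)^{5(k−1)/2}`). [this file] -/
theorem htcLT_seed_row_shell (α₀ σ : Fin 4 → Fin 4 → Fin 4 → ℤ × ℤ × ℤ → ℝ) (i₀ i₁ : Fin 4)
    (d : Fin 4 → ℤ → ℝ) (hne : i₀ ≠ i₁)
    (hsym : IsSymmetricCoeff α₀) (hcanc : IsCancellingCoeff α₀)
    (hpure : ∀ X : Fin 4 → ℤ → ℝ → ℝ, (∀ i n t, i ≠ i₀ → X i n t = 0) →
      ∀ i n t, quadTerm 1 α₀ X i n t = 0)
    (hsad : ∀ (Y : Fin 4 → ℤ → ℝ → ℝ) (i : Fin 4) (n : ℤ) (t : ℝ),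
      quadTerm 1 α₀ (fun j m s => (fun j m (_ : ℝ) => if j = i₀ ∧ m = 0 then (1 : ℝ) else 0) j m s +
          Y j m s) i n t -
        quadTerm 1 α₀ (fun j m (_ : ℝ) => if j = i₀ ∧ m = 0 then (1 : ℝ) else 0) i n t -
        quadTerm 1 α₀ Y i n t = d i n * Y i n t)
    (hpar : ∀ (j₁ j₂ j₃ : Fin 4) (μ : ℤ × ℤ × ℤ),
      Xor (Xor (j₁ = i₁) (j₂ = i₁)) (j₃ = i₁) → α₀ j₁ j₂ j₃ μ = 0)
    (hα1 : ∀ a b c μ, |α₀ a b c μ| ≤ 1)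
    (hσsym : IsSymmetricCoeff σ)
    (hσpar : ∀ (j₁ j₂ j₃ : Fin 4) (μ : ℤ × ℤ × ℤ),
      Xor (Xor (j₁ = i₁) (j₂ = i₁)) (j₃ = i₁) → σ j₁ j₂ j₃ μ = 0)
    {σb : ℝ} (hσ1 : ∀ a b c μ, |σ a b c μ| ≤ σb)
    (β : ℝ) (hβ : 0 ≤ β) (S : Fin 4 → ℤ → ℝ → ℝ) {T : ℝ} (k : ℤ)
    (hS : ∀ i k, ∀ t ∈ Icc 0 T, HasDerivWithinAt (S i k)
      (quadTerm 1 α₀ S i k t + β * quadTerm 1 σ S i k t) (Icc 0 T) t)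
    {M V ι Z A₁ : ℝ}
    (hMu : ∀ t ∈ Icc 0 T, |S i₁ (k - 1) t| ≤ M) (hV : ∀ t ∈ Icc 0 T, |S i₁ k t| ≤ V)
    (hZ : ∀ t ∈ Icc 0 T, ∀ b, |S b (k + 1) t| ≤ Z) (hA : ∀ t ∈ Icc 0 T, ∀ b, |S b k t| ≤ A₁)
    (hι : ∀ t ∈ Icc 0 T, ∀ a, a ≠ i₀ → a ≠ i₁ → |S a (k - 1) t| ≤ ι ∧ |S a k t| ≤ ι) :
    ∃ fv : ℝ → ℝ,
      (∀ t ∈ Icc 0 T, HasDerivWithinAt (S i₁ k)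
        ((1 + 1 : ℝ) ^ ((5 : ℝ) * k / 2) * d i₁ 0 * S i₀ k t * S i₁ k t +
          (1 + 1 : ℝ) ^ ((5 : ℝ) * ((k : ℝ) - 1) / 2) *
            (β * (2 * σ i₁ i₀ i₁ (0, 0, 1)) * S i₀ (k - 1) t * S i₁ (k - 1) t) + fv t) (Icc 0 T) t) ∧
      (∀ t ∈ Icc 0 T, |fv t| ≤
        (1 + 1 : ℝ) ^ ((5 : ℝ) * k / 2) *
            (2 * V * (2 * ι + 4 * Z + 4 * β * σb * (A₁ + Z)) + 2 * Z * (2 * ι + 4 * β * σb * A₁)) +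
          (1 + 1 : ℝ) ^ ((5 : ℝ) * ((k : ℝ) - 1) / 2) * (4 * M * ι * (1 + β * σb))) := by
  obtain ⟨hc0, hc1, -, hc3⟩ := htcTR_trigger_carrier_coefficients α₀ i₀ i₁ d hsym hcanc hpure hsad
  have hpar3 : ∀ μ : ℤ × ℤ × ℤ, α₀ i₁ i₁ i₁ μ = 0 := fun μ => hpar i₁ i₁ i₁ μ (by simp [Xor])
  have hσpar3 : ∀ μ : ℤ × ℤ × ℤ, σ i₁ i₁ i₁ μ = 0 := fun μ => hσpar i₁ i₁ i₁ μ (by simp [Xor])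
  have hσ0 : 0 ≤ σb := (abs_nonneg _).trans (hσ1 i₀ i₀ i₀ (0, 0, 0))
  -- gains
  set γ₀ : ℝ := (1 + 1 : ℝ) ^ ((5 : ℝ) * k / 2) with hγ₀
  set γ₁ : ℝ := (1 + 1 : ℝ) ^ ((5 : ℝ) * ((k : ℝ) - 1) / 2) with hγ₁
  have hγ₀0 : 0 ≤ γ₀ := Real.rpow_nonneg (by norm_num) _
  have hγ₁0 : 0 ≤ γ₁ := Real.rpow_nonneg (by norm_num) _
  refine ⟨fun t => (quadTerm 1 α₀ S i₁ k t + β * quadTerm 1 σ S i₁ k t) -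
      (γ₀ * d i₁ 0 * S i₀ k t * S i₁ k t +
        γ₁ * (β * (2 * σ i₁ i₀ i₁ (0, 0, 1)) * S i₀ (k - 1) t * S i₁ (k - 1) t)), ?_, ?_⟩
  · intro t ht
    exact (hS i₁ k t ht).congr_deriv (by ring)
  · intro t ht
    -- the two trigger rows at shell k
    have hu := htcTR_quadTerm_trigger α₀ i₁ hsym hpar S k t
    have hσ := htcTR_quadTerm_trigger σ i₁ hσsym hσpar S k t
    -- envelopes at time t
    have hj0 : ∀ a, a ≠ i₀ → a ≠ i₁ → |S a (k - 1) t| ≤ ι := fun a h0 h1 => (hι t ht a h0 h1).1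
    have hj1 : ∀ a, a ≠ i₀ → a ≠ i₁ → |S a k t| ≤ ι := fun a h0 h1 => (hι t ht a h0 h1).2
    have hZt : ∀ b, |S b (k + 1) t| ≤ Z := hZ t ht
    have hAt : ∀ b, |S b k t| ≤ A₁ := hA t ht
    have hZ0 : 0 ≤ Z := (abs_nonneg _).trans (hZt i₀)
    have hA0 : 0 ≤ A₁ := (abs_nonneg _).trans (hAt i₀)
    have hV0 : 0 ≤ V := (abs_nonneg _).trans (hV t ht)
    have hM0 : 0 ≤ M := (abs_nonneg _).trans (hMu t ht)
    -- pointwise bounds for products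
    have hjb : ∀ (c z B : ℝ), |c| ≤ 1 → |z| ≤ B → |c * z| ≤ B := fun c z B hc hz => by
      rw [abs_mul]
      calc |c| * |z| ≤ 1 * B := mul_le_mul hc hz (abs_nonneg _) (by norm_num)
        _ = B := one_mul _
    have hσb : ∀ (c z B : ℝ), |c| ≤ σb → |z| ≤ B → |c * z| ≤ σb * B := fun c z B hc hz => by
      rw [abs_mul]; exact mul_le_mul hc hz (abs_nonneg _) hσ0
    -- α₀ sums
    -- (000) at shell k: (e/2) y + junk
    set P₀ : ℝ := ∑ b, α₀ i₁ b i₁ (0, 0, 0) * S b k t - d i₁ 0 / 2 * S i₀ k t with hP₀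
    have hBP₀ : |P₀| ≤ 2 * ι := by
      have h := htcLC_sum_split (fun b => α₀ i₁ b i₁ (0, 0, 0) * S b k t) hne (B := ι)
        (fun a h0 h1 => hjb _ _ _ (hα1 _ _ _ _) (hj1 a h0 h1))
      have key : P₀ = ∑ b, α₀ i₁ b i₁ (0, 0, 0) * S b k t - α₀ i₁ i₀ i₁ (0, 0, 0) * S i₀ k t -
          α₀ i₁ i₁ i₁ (0, 0, 0) * S i₁ k t := by rw [hP₀, hc0, hpar3]; ring
      rw [key]; exact h
    -- (100)a at shell k: ζ · Σ_b α₀ i₁ b i₁ (100) S_{b,1}: generic bound 4 A₁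
    set P₁ : ℝ := ∑ b, α₀ i₁ b i₁ (1, 0, 0) * S b k t with hP₁
    have hBP₁ : |P₁| ≤ 2 * ι := by
      have h := htcLC_sum_split (fun b => α₀ i₁ b i₁ (1, 0, 0) * S b k t) hne (B := ι)
        (fun a h0 h1 => hjb _ _ _ (hα1 _ _ _ _) (hj1 a h0 h1))
      have key : P₁ = ∑ b, α₀ i₁ b i₁ (1, 0, 0) * S b k t - α₀ i₁ i₀ i₁ (1, 0, 0) * S i₀ k t -
          α₀ i₁ i₁ i₁ (1, 0, 0) * S i₁ k t := by rw [hP₁, hc1, hpar3]; ring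
      rw [key]; exact h
    -- (100)b: v · Σ_b α₀ b i₁ i₁ (100) S_{b,2}: generic bound 4 Z
    set P₂ : ℝ := ∑ b, α₀ b i₁ i₁ (1, 0, 0) * S b (k + 1) t with hP₂
    have hBP₂ : |P₂| ≤ 4 * Z := htcLS_abs_sum_le_four _ fun b => hjb _ _ _ (hα1 _ _ _ _) (hZt b)
    -- (001) from shell k-1: u · (junk only)
    set P₃ : ℝ := ∑ b, α₀ i₁ b i₁ (0, 0, 1) * S b (k - 1) t with hP₃
    have hBP₃ : |P₃| ≤ 2 * ι := by
      have h := htcLC_sum_split (fun b => α₀ i₁ b i₁ (0, 0, 1) * S b (k - 1) t) hne (B := ι)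
        (fun a h0 h1 => hjb _ _ _ (hα1 _ _ _ _) (hj0 a h0 h1))
      have key : P₃ = ∑ b, α₀ i₁ b i₁ (0, 0, 1) * S b (k - 1) t - α₀ i₁ i₀ i₁ (0, 0, 1) * S i₀ (k - 1) t -
          α₀ i₁ i₁ i₁ (0, 0, 1) * S i₁ (k - 1) t := by rw [hP₃, hc3, hpar3]; ring
      rw [key]; exact h
    -- σ sums
    set Q₀ : ℝ := ∑ b, σ i₁ b i₁ (0, 0, 0) * S b k t with hQ₀
    have hBQ₀ : |Q₀| ≤ 4 * (σb * A₁) := htcLS_abs_sum_le_four _ fun b => hσb _ _ _ (hσ1 _ _ _ _) (hAt b)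
    set Q₁ : ℝ := ∑ b, σ i₁ b i₁ (1, 0, 0) * S b k t with hQ₁
    have hBQ₁ : |Q₁| ≤ 4 * (σb * A₁) := htcLS_abs_sum_le_four _ fun b => hσb _ _ _ (hσ1 _ _ _ _) (hAt b)
    set Q₂ : ℝ := ∑ b, σ b i₁ i₁ (1, 0, 0) * S b (k + 1) t with hQ₂
    have hBQ₂ : |Q₂| ≤ 4 * (σb * Z) := htcLS_abs_sum_le_four _ fun b => hσb _ _ _ (hσ1 _ _ _ _) (hZt b)
    -- σ (001) from shell k-1: the SEED (s/2)·x + junk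
    set Q₃ : ℝ := ∑ b, σ i₁ b i₁ (0, 0, 1) * S b (k - 1) t - σ i₁ i₀ i₁ (0, 0, 1) * S i₀ (k - 1) t with hQ₃
    have hBQ₃ : |Q₃| ≤ 2 * (σb * ι) := by
      have h := htcLC_sum_split (fun b => σ i₁ b i₁ (0, 0, 1) * S b (k - 1) t) hne (B := σb * ι)
        (fun a h0 h1 => hσb _ _ _ (hσ1 _ _ _ _) (hj0 a h0 h1))
      have key : Q₃ = ∑ b, σ i₁ b i₁ (0, 0, 1) * S b (k - 1) t - σ i₁ i₀ i₁ (0, 0, 1) * S i₀ (k - 1) t -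
          σ i₁ i₁ i₁ (0, 0, 1) * S i₁ (k - 1) t := by rw [hQ₃, hσpar3]; ring
      rw [key]; exact h
    -- the identity
    have heq : (quadTerm 1 α₀ S i₁ k t + β * quadTerm 1 σ S i₁ k t) -
        (γ₀ * d i₁ 0 * S i₀ k t * S i₁ k t +
          γ₁ * (β * (2 * σ i₁ i₀ i₁ (0, 0, 1)) * S i₀ (k - 1) t * S i₁ (k - 1) t)) =
        γ₀ * (2 * S i₁ k t * P₀ + 2 * S i₁ (k + 1) t * P₁ + 2 * S i₁ k t * P₂) +
          γ₁ * (2 * S i₁ (k - 1) t * P₃) +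
          β * (γ₀ * (2 * S i₁ k t * Q₀ + 2 * S i₁ (k + 1) t * Q₁ + 2 * S i₁ k t * Q₂) +
            γ₁ * (2 * S i₁ (k - 1) t * Q₃)) := by
      rw [hu, hσ, hP₀, hP₁, hP₂, hP₃, hQ₀, hQ₁, hQ₂, hQ₃]; ring
    show |(quadTerm 1 α₀ S i₁ k t + β * quadTerm 1 σ S i₁ k t) -
        (γ₀ * d i₁ 0 * S i₀ k t * S i₁ k t +
          γ₁ * (β * (2 * σ i₁ i₀ i₁ (0, 0, 1)) * S i₀ (k - 1) t * S i₁ (k - 1) t))| ≤ _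
    rw [heq]
    -- term bounds
    have hv := hV t ht
    have hz := hZt i₁
    have huM := hMu t ht
    have t1 : |2 * S i₁ k t * P₀| ≤ 2 * V * (2 * ι) := by
      rw [abs_mul, abs_mul, abs_two]
      exact mul_le_mul (by linarith) hBP₀ (abs_nonneg _) (by linarith)
    have t2 : |2 * S i₁ (k + 1) t * P₁| ≤ 2 * Z * (2 * ι) := by
      rw [abs_mul, abs_mul, abs_two]
      exact mul_le_mul (by linarith) hBP₁ (abs_nonneg _) (by linarith)
    have t3 : |2 * S i₁ k t * P₂| ≤ 2 * V * (4 * Z) := by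
      rw [abs_mul, abs_mul, abs_two]
      exact mul_le_mul (by linarith) hBP₂ (abs_nonneg _) (by linarith)
    have t4 : |2 * S i₁ (k - 1) t * P₃| ≤ 2 * M * (2 * ι) := by
      rw [abs_mul, abs_mul, abs_two]
      exact mul_le_mul (by linarith) hBP₃ (abs_nonneg _) (by linarith)
    have t5 : |2 * S i₁ k t * Q₀| ≤ 2 * V * (4 * (σb * A₁)) := by
      rw [abs_mul, abs_mul, abs_two]
      exact mul_le_mul (by linarith) hBQ₀ (abs_nonneg _) (by linarith)
    have t6 : |2 * S i₁ (k + 1) t * Q₁| ≤ 2 * Z * (4 * (σb * A₁)) := by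
      rw [abs_mul, abs_mul, abs_two]
      exact mul_le_mul (by linarith) hBQ₁ (abs_nonneg _) (by linarith)
    have t7 : |2 * S i₁ k t * Q₂| ≤ 2 * V * (4 * (σb * Z)) := by
      rw [abs_mul, abs_mul, abs_two]
      exact mul_le_mul (by linarith) hBQ₂ (abs_nonneg _) (by linarith)
    have t8 : |2 * S i₁ (k - 1) t * Q₃| ≤ 2 * M * (2 * (σb * ι)) := by
      rw [abs_mul, abs_mul, abs_two]
      exact mul_le_mul (by linarith) hBQ₃ (abs_nonneg _) (by linarith)
    -- blocks
    set X₀ := 2 * S i₁ k t * P₀ + 2 * S i₁ (k + 1) t * P₁ + 2 * S i₁ k t * P₂ with hX₀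
    set X₁ := 2 * S i₁ (k - 1) t * P₃ with hX₁
    set Y₀ := 2 * S i₁ k t * Q₀ + 2 * S i₁ (k + 1) t * Q₁ + 2 * S i₁ k t * Q₂ with hY₀
    set Y₁ := 2 * S i₁ (k - 1) t * Q₃ with hY₁
    have hX₀b : |X₀| ≤ 2 * V * (2 * ι) + 2 * Z * (2 * ι) + 2 * V * (4 * Z) := by
      calc |X₀| ≤ |2 * S i₁ k t * P₀ + 2 * S i₁ (k + 1) t * P₁| + |2 * S i₁ k t * P₂| := abs_add_le _ _
        _ ≤ |2 * S i₁ k t * P₀| + |2 * S i₁ (k + 1) t * P₁| + |2 * S i₁ k t * P₂| := by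
            linarith [abs_add_le (2 * S i₁ k t * P₀) (2 * S i₁ (k + 1) t * P₁)]
        _ ≤ _ := by linarith
    have hY₀b : |Y₀| ≤ 2 * V * (4 * (σb * A₁)) + 2 * Z * (4 * (σb * A₁)) + 2 * V * (4 * (σb * Z)) := by
      calc |Y₀| ≤ |2 * S i₁ k t * Q₀ + 2 * S i₁ (k + 1) t * Q₁| + |2 * S i₁ k t * Q₂| := abs_add_le _ _
        _ ≤ |2 * S i₁ k t * Q₀| + |2 * S i₁ (k + 1) t * Q₁| + |2 * S i₁ k t * Q₂| := by
            linarith [abs_add_le (2 * S i₁ k t * Q₀) (2 * S i₁ (k + 1) t * Q₁)]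
        _ ≤ _ := by linarith
    have h1 : |γ₀ * X₀| ≤ γ₀ * (2 * V * (2 * ι) + 2 * Z * (2 * ι) + 2 * V * (4 * Z)) := by
      rw [abs_mul, abs_of_nonneg hγ₀0]; exact mul_le_mul_of_nonneg_left hX₀b hγ₀0
    have h2 : |γ₁ * X₁| ≤ γ₁ * (2 * M * (2 * ι)) := by
      rw [abs_mul, abs_of_nonneg hγ₁0]; exact mul_le_mul_of_nonneg_left t4 hγ₁0
    have h3 : |γ₀ * Y₀| ≤ γ₀ * (2 * V * (4 * (σb * A₁)) + 2 * Z * (4 * (σb * A₁)) + 2 * V * (4 * (σb * Z))) := by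
      rw [abs_mul, abs_of_nonneg hγ₀0]; exact mul_le_mul_of_nonneg_left hY₀b hγ₀0
    have h4 : |γ₁ * Y₁| ≤ γ₁ * (2 * M * (2 * (σb * ι))) := by
      rw [abs_mul, abs_of_nonneg hγ₁0]; exact mul_le_mul_of_nonneg_left t8 hγ₁0
    have h5 : |β * (γ₀ * Y₀ + γ₁ * Y₁)| ≤
        β * (γ₀ * (2 * V * (4 * (σb * A₁)) + 2 * Z * (4 * (σb * A₁)) + 2 * V * (4 * (σb * Z))) +
          γ₁ * (2 * M * (2 * (σb * ι)))) := by
      rw [abs_mul, abs_of_nonneg hβ]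
      refine mul_le_mul_of_nonneg_left ?_ hβ
      calc |γ₀ * Y₀ + γ₁ * Y₁| ≤ |γ₀ * Y₀| + |γ₁ * Y₁| := abs_add_le _ _
        _ ≤ _ := by linarith
    calc |γ₀ * X₀ + γ₁ * X₁ + β * (γ₀ * Y₀ + γ₁ * Y₁)|
        ≤ |γ₀ * X₀ + γ₁ * X₁| + |β * (γ₀ * Y₀ + γ₁ * Y₁)| := abs_add_le _ _
      _ ≤ |γ₀ * X₀| + |γ₁ * X₁| + |β * (γ₀ * Y₀ + γ₁ * Y₁)| := by linarith [abs_add_le (γ₀ * X₀) (γ₁ * X₁)]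
      _ ≤ γ₀ * (2 * V * (2 * ι) + 2 * Z * (2 * ι) + 2 * V * (4 * Z)) + γ₁ * (2 * M * (2 * ι)) +
          β * (γ₀ * (2 * V * (4 * (σb * A₁)) + 2 * Z * (4 * (σb * A₁)) + 2 * V * (4 * (σb * Z))) +
            γ₁ * (2 * M * (2 * (σb * ι)))) := by linarith
      _ = _ := by ring

end Summit.NavierStokesRegularity.NavierStokesRegularity.Theorems

end
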